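import Literature.Barriers.CriticalPhenomena.LongRangeTrivialityOnZ3Reduction

/-!
# The two printed inputs of Panis's Theorem 1.2: the moment-generating-function bound through
# `S(β,L,f) = Σ_L⁻² ∑|U₄|`, and the bound on `S(β,L,f)` for effective dimension `> 4`

Sibling of `Literature/Barriers/CriticalPhenomena/LongRangeTrivialityOnZ3.lean` (barrier catalogue
D-0021, sub-problem `Ising3DConformalLimit`). After `LongRangeTrivialityOnZ3Reduction.lean` the barrier
`LongRangeTrivialityOnZ3` rests on the single named fact `panis_thm12` (Panis 2023, Theorem 1.2).
Theorem 1.2 is the case "algebraically decaying couplings, `d - 2(α∧2) > 0`" of Theorem 5.5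
(Remark 5.4), and the printed proof of Theorem 5.5 (pp. 21–22 of arXiv:2309.05797) is the
composition of two displayed estimates, which this file vendors as named facts **as printed** and
composes (PROVED):

1. `panis_mgfDeviation_le_ursellFourBoxSum` — the second display of the proof (p. 21):
   "Multiplying by `z^{2n}/(2n)!` and summing [the first, numbered display of the proof — labelled
   (5.1) only in this docstring's first version; the held text does not resolve equation numbers] over `n`,
   one gets
   `|⟨exp(zT_{f,L,β})⟩_β - exp((z²/2)⟨T_{f,L,β}²⟩_β)| ≤ C₁ z⁴ exp((z²/2)⟨T_{|f|,L,β}²⟩_β) ‖f‖_∞⁴ S(β,L,f)`",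
   where `S(β,L,f) := ∑_{x₁,…,x₄ ∈ Λ_{r_f L}} |U₄^β(x₁,…,x₄)| / Σ_L(β)²` (first display), that first
   display being Proposition 4.6 (Aizenman's deviation from Wick's law, via random currents) smeared
   against `f` — the moment-level split vendored/proved for the NEAREST-NEIGHBOUR model and its DLR
   measures in `Literature/Probability/LatticeModels/HighDimTrivialityMoments.lean`
   (`aizenman_evenMoment_deviation_le`, `newman_evenMoment_le`, the proved summation
   `abs_mgf_sub_exp_le_of_moment_bounds`), and carried out for the present long-range state in
   `LongRangeTrivialityOnZ3Moments.lean`.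
   Behind it: Prop. 4.6, Gaussian domination of the even moments of `T_{|f|,L,β}`, flip symmetry.
2. `panis_ursellFourBoxSum_le` — the rest of the proof (p. 22): `S(β,L,f)/2 ≤ (1) + (2)` with
   `(1) ≤ C₄β⁻⁴ r_f^{8+d} L^{-(d+2η-4)}` and `(2) ≤ C₉β⁻² r_f^{8+d-2η} L^{-(d+2η-4)}`, where for
   `J_{x,y} = C₀|x-y|₁^{-d-α}` one has `d + 2η - 4 ≥ d - 2(α∧2)`, with equality for the admissible
   choice `η = (2-α)₊` (Remark 5.3: `η ≥ |2-α|₊`; Remark 5.4; and the infrared bound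
   `⟨σ₀σ_x⟩_β ≤ C (log|x|)^{δ_{α,2}}/(β_c|x|^{d-α∧2})` displayed at the end of §3.6, p. 16). Behind it: the tree diagram bound
   `|U₄| ≤ 2∑_u∏ᵢ⟨σ_uσ_{xᵢ}⟩` (§4.2, after [A]), the sliding-scale infrared bound Theorem 3.18 [ADC],
   the Messager–Miracle-Solé inequalities Prop. 3.2/Cor. 3.3 with `χ_L ≤ C L^{-d}Σ_L`, and the
   infrared bound Prop. 3.8 for reflection-positive long-range couplings.

Both are stated for the algebraically decaying family only (the setting of Theorem 1.2), for
`0 < β ≤ β_c`, natural `L ≥ 1`, and with the support radius `r_f` replaced by any natural `R ≥ 1`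
with `f = 0` off `[-R,R]^d` (then `Λ_{r_f L} ⊆ Λ_{RL}`, so each vendored inequality is implied by the
printed one, the constants' dependence on `r_f` becoming `R^γ`).

PROVED here: `panis_thm12_of_inputs : panis_mgfDeviation_le_ursellFourBoxSum →
panis_ursellFourBoxSum_le → panis_thm12` (multiply the two displays; the `f`-dependence
`C₁‖f‖_∞⁴ R^γ` is absorbed into the constant of the vendored `panis_thm12`), hence
`LongRangeTrivialityOnZ3.of_inputs`. The trust base of the barrier becomes these two printed
displays; each is the target of a further reduction (moment level / two-point-function level).

## Definitions (namespace `Literature.Barriers.CriticalPhenomena.LongRangeIsing`)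

`pairCorrelation J β x y = ⟨σ_xσ_y⟩_{J,0,β}`, `fourCorrelation`, `ursellFour` (`U₄^β`),
`boxSusceptibility J β L = χ_L(β)`, `ursellFourBoxSum J β L R = Σ_L(β)⁻² ∑_{Λ_{RL}⁴} |U₄^β|`
(all through the infinite-volume state `LongRangeIsing.state`, a `limUnder` along boxes — an actual
limit for `J ≥ 0`, `β ≥ 0` on these local observables).

## References

* R. Panis, arXiv:2309.05797 (2023) = Ann. Probab. 54 (2026): §1.2.1 (display defining `U₄^β`),
  §3 (displays defining `S_{ρ,β}(x)`, `χ_L(ρ,β)`), Theorem 1.2, Theorem 5.5 and its proof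
  (pp. 21–22), Remark 5.4 [Panis2023Triviality] (held; read).
* M. Aizenman, Comm. Math. Phys. 86 (1982) 1–48 (Prop. 12.1, tree diagram bound) — as cited there.
-/

noncomputable section

namespace Literature.Barriers.CriticalPhenomena

open Literature.Probability.LatticeModels Literature.Probability.Percolation Filter Topology Finset
open scoped symmDiff

namespace LongRangeIsing

variable {d : ℕ}

/-! ### Correlation functions of the infinite-volume state -/

/-- The two-point function `S_β(x,y) = ⟨σ_x σ_y⟩_{J,0,β}` of the infinite-volume zero-field state.
[cite: Panis2023Triviality, §3 (display defining S_{ρ,β}(x)) and §1.2.1 (Σ_L(β) = ∑⟨σ_xσ_y⟩_β)] -/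
def pairCorrelation (J : Site d → Site d → ℝ) (β : ℝ) (x y : Site d) : ℝ :=
  state J β 0 fun σ => spinAt x σ * spinAt y σ

/-- The four-point function `⟨σ_x σ_y σ_z σ_t⟩_{J,0,β}`. [cite: Panis2023Triviality, §1.2.1 (display defining U_4^β)] -/
def fourCorrelation (J : Site d → Site d → ℝ) (β : ℝ) (x y z t : Site d) : ℝ :=
  state J β 0 fun σ => spinAt x σ * spinAt y σ * spinAt z σ * spinAt t σ

/-- **The four-point Ursell function**
`U₄^β(x,y,z,t) := ⟨σ_xσ_yσ_zσ_t⟩_β - ⟨σ_xσ_y⟩_β⟨σ_zσ_t⟩_β - ⟨σ_xσ_z⟩_β⟨σ_yσ_t⟩_β - ⟨σ_xσ_t⟩_β⟨σ_yσ_z⟩_β`.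
[cite: Panis2023Triviality, §1.2.1 (display defining U_4^β)] -/
def ursellFour (J : Site d → Site d → ℝ) (β : ℝ) (x y z t : Site d) : ℝ :=
  fourCorrelation J β x y z t - pairCorrelation J β x y * pairCorrelation J β z t -
    pairCorrelation J β x z * pairCorrelation J β y t - pairCorrelation J β x t * pairCorrelation J β y z

/-- The finite-volume susceptibility `χ_L(β) := ∑_{x ∈ Λ_L} ⟨σ_0 σ_x⟩_β`.
[cite: Panis2023Triviality, §3 (display defining χ_L(ρ,β))] -/
def boxSusceptibility (J : Site d → Site d → ℝ) (β : ℝ) (L : ℕ) : ℝ :=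
  ∑ x ∈ box d L, pairCorrelation J β 0 x

/-- Panis's `S(β,L,f)` with the support radius `r_f` replaced by a natural number `R`:
`S(β,L,R) := Σ_L(β)⁻² ∑_{x₁,x₂,x₃,x₄ ∈ Λ_{RL}} |U₄^β(x₁,x₂,x₃,x₄)|` (junk `·/0 = 0` if `Σ_L(β) = 0`,
impossible for `J ≥ 0`, `β ≥ 0` by `one_le_blockVariance`).
[cite: Panis2023Triviality, proof of Theorem 5.5, first display (definition of S(β,L,f)), p. 21] -/
def ursellFourBoxSum (J : Site d → Site d → ℝ) (β : ℝ) (L R : ℕ) : ℝ :=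
  (∑ x ∈ Fintype.piFinset fun _ : Fin 4 => box d (R * L), |ursellFour J β (x 0) (x 1) (x 2) (x 3)|) /
    blockVariance J β L ^ 2

/-- `pairCorrelation` is the two-point function `⟨σ_{{x}∆{y}}⟩` used in `LongRangeTrivialityOnZ3Proofs`. [folklore] -/
theorem pairCorrelation_eq (J : Site d → Site d → ℝ) (β : ℝ) (x y : Site d) :
    pairCorrelation J β x y = state J β 0 (spinProduct ({x} ∆ {y})) := by
  rw [pairCorrelation]
  congr 1
  funext σ
  exact spinAt_mul_spinAt_eq_spinProduct x y σ

/-- `S(β,L,R) ≥ 0`. [folklore] -/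
theorem ursellFourBoxSum_nonneg (J : Site d → Site d → ℝ) (β : ℝ) (L R : ℕ) : 0 ≤ ursellFourBoxSum J β L R :=
  div_nonneg (Finset.sum_nonneg fun _ _ => abs_nonneg _) (sq_nonneg _)

end LongRangeIsing

open LongRangeIsing

/-! ### The two printed displays of the proof of Theorem 5.5 (named facts) -/

/-- NAMED FACT — **Panis 2023, proof of Theorem 5.5, second display (the moment generating
function is controlled by `S(β,L,f)`).** Under the hypotheses of Theorem 5.5 — here for the
algebraically decaying reflection-positive couplings `J_{x,y} = C₀|x-y|₁^{-d-α}`, `C₀, α > 0`,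
`d - 2(α∧2) > 0` (which satisfy (A1)–(A5) and, by Remark 5.4, the effective-dimension condition of
§5) — for `f ∈ C_0(ℝ^d)`, `β ≤ β_c`, `L ≥ 1` and real `z`: "Multiplying by `z^{2n}/(2n)!` and summing
[the first display of the proof] over `n`, one gets
`|⟨exp(z T_{f,L,β}(σ))⟩_β - exp((z²/2)⟨T_{f,L,β}(σ)²⟩_β)| ≤ C₁ z⁴ exp((z²/2)⟨T_{|f|,L,β}(σ)²⟩_β) ‖f‖_∞⁴ S(β,L,f)`",
with `S(β,L,f) = ∑_{x₁,…,x₄∈Λ_{r_fL}} |U₄^β(x₁,…,x₄)| / Σ_L(β)²` (the first display being Proposition 4.6,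
Aizenman's deviation from Wick's law, smeared; cf. `aizenman_evenMoment_deviation_le` of
`HighDimTrivialityMoments` for the nearest-neighbour rendering). Vendored for `0 < β ≤ β_c`, natural `L ≥ 1`, and `Λ_{RL}`,
`R ≥ 1` any natural number with `f = 0` off `[-R,R]^d`, in place of `Λ_{r_fL}` (weaker: the sum of
`|U₄| ≥ 0` over the larger box is larger); `C₁` may depend on `d, C₀, α`. Users take
`(h : panis_mgfDeviation_le_ursellFourBoxSum)`.
[cite: Panis2023Triviality, proof of Theorem 5.5, first two displays (p. 21)] -/
def panis_mgfDeviation_le_ursellFourBoxSum : Prop :=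
  ∀ (d : ℕ), 1 ≤ d → ∀ (C₀ α : ℝ), 0 < C₀ → 0 < α → 0 < (d : ℝ) - 2 * min α 2 →
    ∃ C₁ : ℝ, 0 < C₁ ∧
      ∀ (β : ℝ), 0 < β → β ≤ LongRangeIsing.criticalBeta (algebraicCoupling d C₀ α) →
        ∀ (L R : ℕ), 1 ≤ L → 1 ≤ R →
          ∀ (f : EuclideanSpace ℝ (Fin d) → ℝ), Continuous f → (∀ x, f x ≠ 0 → ∀ i, |x i| ≤ R) →
            ∀ (z : ℝ),
              mgfDeviation (algebraicCoupling d C₀ α) β L f z ≤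
                C₁ * z ^ 4 *
                  Real.exp (z ^ 2 / 2 * state (algebraicCoupling d C₀ α) β 0
                    (fun σ => smeared (algebraicCoupling d C₀ α) β L (fun x => |f x|) σ ^ 2)) *
                  (⨆ x, |f x|) ^ 4 * ursellFourBoxSum (algebraicCoupling d C₀ α) β L R

/-- NAMED FACT — **Panis 2023, proof of Theorem 5.5, the bound on `S(β,L,f)` (p. 22), in the
setting of Theorem 1.2.** "Applying the tree diagram bound … Splitting the sum …
`S(β,L,f)/2 ≤ (1) + (2)`", "(1) `≤ C₄ β⁻⁴ r_f^{8+d} L^{-(d+2η-4)}`", "(2) `≤ C₉ β⁻² r_f^{8+d-2η} L^{-(d+2η-4)}`",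
for all `β ≤ β_c`, `L ≥ 1`, under (A1)–(A5) and the effective-dimension condition
`⟨σ₀σ_x⟩_{β_c} ≤ 𝐂/|x|^{d-2+η}`, `d + 2η > 4`; for `J_{x,y} = C₀|x-y|₁^{-d-α}` with `d - 2(α∧2) > 0`
this condition holds with some `η ≥ (2-α)₊` (Remark 5.3), so `d + 2η - 4 ≥ d - 2(α∧2)` with equality for
the admissible choice `η = (2-α)₊` (Remark 5.4, and the exponent of Theorem 1.2).
Vendored as: there are `C, γ > 0` with `S(β,L,R) ≤ C (β⁻⁴ ∨ β⁻²) R^γ / L^{d-2(α∧2)}` for all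
`0 < β ≤ β_c`, natural `L ≥ 1`, `R ≥ 1` (`R` in place of `r_f`). Inputs of the printed proof: the
tree diagram bound (§4.2), the sliding-scale infrared bound (Theorem 3.18), the
Messager–Miracle-Solé inequalities (Corollary 3.3) with `χ_L ≤ C₂L^{-d}Σ_L`, and the infrared bound
for these couplings (Proposition 3.8, p. 16). Users take `(h : panis_ursellFourBoxSum_le)`.
[cite: Panis2023Triviality, proof of Theorem 5.5, bounds on (1) and (2) (p. 22), with Remark 5.4] -/
def panis_ursellFourBoxSum_le : Prop :=
  ∀ (d : ℕ), 1 ≤ d → ∀ (C₀ α : ℝ), 0 < C₀ → 0 < α → 0 < (d : ℝ) - 2 * min α 2 →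
    ∃ C γ : ℝ, 0 < C ∧ 0 < γ ∧
      ∀ (β : ℝ), 0 < β → β ≤ LongRangeIsing.criticalBeta (algebraicCoupling d C₀ α) →
        ∀ (L R : ℕ), 1 ≤ L → 1 ≤ R →
          ursellFourBoxSum (algebraicCoupling d C₀ α) β L R ≤
            C * max (β ^ (-(4 : ℝ))) (β ^ (-(2 : ℝ))) * (R : ℝ) ^ γ / (L : ℝ) ^ ((d : ℝ) - 2 * min α 2)

/-! ### Theorem 1.2 from the two displays -/

/-- A compactly supported function on `ℝ^d` vanishes off `[-R,R]^d` for some natural `R ≥ 1`.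
[folklore] -/
theorem exists_nat_forall_abs_apply_le {d : ℕ} (f : EuclideanSpace ℝ (Fin d) → ℝ) (hfs : HasCompactSupport f) :
    ∃ R : ℕ, 1 ≤ R ∧ ∀ x, f x ≠ 0 → ∀ i, |x i| ≤ R := by
  obtain ⟨R₀, _, hR₀⟩ := hfs.exists_pos_le_norm
  refine ⟨max 1 ⌈R₀⌉₊, le_max_left _ _, fun x hx i => ?_⟩
  have hlt : ‖x‖ < R₀ := lt_of_not_ge fun h' => hx (hR₀ x h')
  have hi : |x i| ≤ ‖x‖ := by
    have h := PiLp.norm_apply_le x i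
    rwa [Real.norm_eq_abs] at h
  calc |x i| ≤ R₀ := (hi.trans hlt.le)
    _ ≤ ⌈R₀⌉₊ := Nat.le_ceil R₀
    _ ≤ ((max 1 ⌈R₀⌉₊ : ℕ) : ℝ) := by exact_mod_cast le_max_right 1 ⌈R₀⌉₊

/-- **Theorem 1.2 from the two printed displays of the proof of Theorem 5.5**: the moment
generating function bound through `S(β,L,f)` times the bound on `S(β,L,f)`; the factor
`C₁ ‖f‖_∞⁴ R^γ` is absorbed into the (`f`-dependent) constant of the vendored `panis_thm12`.
[cite: Panis2023Triviality, proof of Theorem 5.5 (pp. 21–22) and Remark 5.4] -/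
theorem panis_thm12_of_inputs (hM : panis_mgfDeviation_le_ursellFourBoxSum)
    (hS : panis_ursellFourBoxSum_le) : panis_thm12 := by
  intro d hd C₀ α hC₀ hα hexp f hf hfs
  set J := algebraicCoupling d C₀ α with hJ
  obtain ⟨C₁, hC₁, hMb⟩ := hM d hd C₀ α hC₀ hα hexp
  obtain ⟨C, γ, hC, _, hSb⟩ := hS d hd C₀ α hC₀ hα hexp
  obtain ⟨R, hR, hfR⟩ := exists_nat_forall_abs_apply_le f hfs
  set F : ℝ := (⨆ x, |f x|) ^ 4 with hF
  have hF0 : 0 ≤ F := pow_nonneg (Real.iSup_nonneg fun x => abs_nonneg (f x)) 4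
  refine ⟨C₁ * (F + 1) * C * (R : ℝ) ^ γ, by positivity, fun β hβ hβc L hL z => ?_⟩
  set V : ℝ := state J β 0 (fun σ => smeared J β L (fun x => |f x|) σ ^ 2) with hV
  set m : ℝ := max (β ^ (-(4 : ℝ))) (β ^ (-(2 : ℝ))) with hm
  set E : ℝ := (L : ℝ) ^ ((d : ℝ) - 2 * min α 2) with hE
  have hm0 : 0 ≤ m := le_max_of_le_left (Real.rpow_nonneg hβ.le _)
  have hE0 : 0 < E := Real.rpow_pos_of_pos (by exact_mod_cast hL) _
  have h1 := hMb β hβ hβc L R hL hR f hf hfR z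
  have h2 := hSb β hβ hβc L R hL hR
  have hS0 : 0 ≤ ursellFourBoxSum J β L R := ursellFourBoxSum_nonneg J β L R
  calc mgfDeviation J β L f z
      ≤ C₁ * z ^ 4 * Real.exp (z ^ 2 / 2 * V) * F * ursellFourBoxSum J β L R := h1
    _ ≤ C₁ * z ^ 4 * Real.exp (z ^ 2 / 2 * V) * (F + 1) * (C * m * (R : ℝ) ^ γ / E) := by
        apply mul_le_mul _ h2 hS0 (by positivity)
        exact mul_le_mul_of_nonneg_left (by linarith) (by positivity)
    _ = Real.exp (z ^ 2 / 2 * V) * (C₁ * (F + 1) * C * (R : ℝ) ^ γ * m * z ^ 4 / E) := by ring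

/-- **The barrier `LongRangeTrivialityOnZ3` granted the two printed displays of the proof of
Panis's Theorem 5.5** (through `panis_thm12_of_inputs` and `LongRangeTrivialityOnZ3.of_thm12`).
[cite: Panis2023Triviality, Theorem 1.2 and proof of Theorem 5.5] -/
theorem LongRangeTrivialityOnZ3.of_inputs (hM : panis_mgfDeviation_le_ursellFourBoxSum)
    (hS : panis_ursellFourBoxSum_le) : LongRangeTrivialityOnZ3 :=
  LongRangeTrivialityOnZ3.of_thm12 (panis_thm12_of_inputs hM hS)

end Literature.Barriers.CriticalPhenomena

end
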